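import Summits.RiemannHypothesis.RiemannHypothesis.Theorems.GroundBartaEvenWinsBeyondArchLatticeRippleTChainMoments
import HarnessLib

/-!
# RiemannHypothesis / GroundBarta machinery — LATTICE RIPPLES: kernel-FAST forms of the chain sup bound and |σ_X|-moments

Helper file (`--supports stmt-RiemannHypothesis-18085`; format A′ infrastructure, memo
`run/shared/lean/pub/rh-explicit/rh-explicit-weil-1/FORMAT-PHANTOM.md`), RH-free, axioms standard.  Seat rh-explicit-weil-1.

`XTCell.absQ` (the sup bound of a Taylor-sum cell, file `…LatticeRippleTaylorCells`) re-expands the global-basis polynomial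
through `XTCell.pcoef`, whose binomials are Mathlib's `Nat.choose` — exponentially recursive under kernel evaluation
(`Σ_{l,i<24} C(l,i) ≈ 2^24` additions per cell).  One cell is fine (`checkZ`, ≈ 9 s); a whole 240-cell chain inside ONE
`decide` (as `WeilCert23X.kappaExact` demands through `xCellsBndMaxQ` / `xCellsAbsMomentQ`) is not (rh-explicit-weil-6,
2026-08-22: «Decidable instance did not reduce» on a 160-cell chain).  This file gives provably-equal FAST twins with the
linear binomial `l.descFactorial i / i!`:

* `XTCell.binomQ`, `binomQ_eq`; `XTCell.pcoefF`, `pcoefF_eq`; `XTCell.absQF`, `absQF_eq`;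
* `xCellsBndMaxQF`, `xCellsBndMaxQF_eq`; `xCellsAbsMomentQF`, `xCellsAbsMomentQF_eq`
  (usage: `rw [← xCellsBndMaxQF_eq]; decide +kernel` evaluates a 240-cell chain in seconds);
* `xCellsBndMaxQ_append` — `max` over `++`, for per-chunk facts.
Everything here is proved; no named facts.
-/

set_option linter.dupNamespace false

noncomputable section

namespace Summit.RiemannHypothesis.RiemannHypothesis.Theorems.EvenWinsBeyondArch

open Literature.NumberTheory.LFunctions

namespace XTCell

variable (c : XTCell)

/-- The binomial `C(l,i)` as `l·(l−1)⋯(l−i+1) / i!` (linear kernel cost). [folklore] -/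
def binomQ (l i : ℕ) : ℚ := ((l.descFactorial i / i.factorial : ℕ) : ℚ)

/-- `binomQ l i = C(l,i)`. [folklore] -/
theorem binomQ_eq (l i : ℕ) : binomQ l i = ((l.choose i : ℕ) : ℚ) := by
  rw [binomQ, Nat.choose_eq_descFactorial_div_factorial]

/-- Fast twin of `pcoef`. [folklore] -/
def pcoefF (i : ℕ) : ℚ := sumR c.dcoeffs.length fun l ↦ getV c.dcoeffs l * binomQ l i * c.u ^ (l - i)

/-- `pcoefF = pcoef`. [folklore] -/
theorem pcoefF_eq (i : ℕ) : c.pcoefF i = c.pcoef i := by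
  unfold pcoefF pcoef
  simp_rw [binomQ_eq]

/-- Fast twin of `absQ`. [folklore] -/
def absQF : ℚ := (sumR c.n fun i ↦ |c.pcoefF i| * (c.v - c.u) ^ i) + |c.eps|

/-- `absQF = absQ`. [folklore] -/
theorem absQF_eq : c.absQF = c.absQ := by
  unfold absQF absQ
  simp_rw [pcoefF_eq]

end XTCell

/-- Fast twin of `xCellsBndMaxQ`. [folklore] -/
def xCellsBndMaxQF : List XTCell → ℚ
  | [] => 0
  | c :: cs => max c.absQF (xCellsBndMaxQF cs)

/-- `xCellsBndMaxQF = xCellsBndMaxQ`. [folklore] -/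
theorem xCellsBndMaxQF_eq : ∀ cells : List XTCell, xCellsBndMaxQF cells = xCellsBndMaxQ cells
  | [] => rfl
  | c :: cs => by rw [xCellsBndMaxQF, xCellsBndMaxQ, c.absQF_eq, xCellsBndMaxQF_eq cs]

/-- Fast twin of `xCellsAbsMomentQ`. [folklore] -/
def xCellsAbsMomentQF : List XTCell → ℕ → ℚ
  | [], _ => 0
  | c :: cs, q => c.absQF * c.powIntQ (q + 1) + xCellsAbsMomentQF cs q

/-- `xCellsAbsMomentQF = xCellsAbsMomentQ`. [folklore] -/
theorem xCellsAbsMomentQF_eq : ∀ (cells : List XTCell) (q : ℕ), xCellsAbsMomentQF cells q = xCellsAbsMomentQ cells q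
  | [], _ => rfl
  | c :: cs, q => by rw [xCellsAbsMomentQF, xCellsAbsMomentQ, c.absQF_eq, xCellsAbsMomentQF_eq cs q]

/-- `xCellsBndMaxQ` over a concatenation is the `max` of the parts. [folklore] -/
theorem xCellsBndMaxQ_append : ∀ l₁ l₂ : List XTCell,
    xCellsBndMaxQ (l₁ ++ l₂) = max (xCellsBndMaxQ l₁) (xCellsBndMaxQ l₂)
  | [], l₂ => by rw [List.nil_append, xCellsBndMaxQ, max_eq_right (xCellsBndMaxQ_nonneg l₂)]
  | c :: cs, l₂ => by rw [List.cons_append, xCellsBndMaxQ, xCellsBndMaxQ, xCellsBndMaxQ_append cs l₂, max_assoc]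

end Summit.RiemannHypothesis.RiemannHypothesis.Theorems.EvenWinsBeyondArch

end
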